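import Literature.AlgebraicGeometry.Motives.SeparatedQuotient
import Mathlib.Data.Complex.Basic
import HarnessLib

/-!
# The quotient of `∐_Δ S` by the translation action is `S`: every summand maps isomorphically onto a
# separated quotient

Topic `AlgebraicGeometry/Motives`; namespace `Literature.AlgebraicGeometry.Motives`.  THEOREMS ONLY (no definition, no
named fact).

Setting: a field `k`, `k`-schemes `S Y Z : SchemeOver k`, a group `Δ`, a colimit cofan `ι : Δ → (S ⟶ Y)` exhibiting
`Y` as the coproduct `∐_{δ ∈ Δ} S` of copies of `S`, automorphisms `act g : Y ≅ Y` (`g ∈ Δ`) permuting the copies by LEFT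
TRANSLATION (`ι δ ≫ act g = ι (g δ)`), and a `k`-morphism `p : Y ⟶ Z` which is a quotient of `Y` by the `act g` for
separated test objects (`Motives.IsSepQuotient act p`), with `S` and `Z` separated over `k`.

* API of the predicate `Motives.IsSepQuotient` (`Motives/SeparatedQuotient.lean`): `hom_comp` / `inv_comp` (invariance),
  `existsUnique` (the universal property), `hom_ext` (cancellation of `p` against separated targets).
* `IsSepQuotient.isIso_cofanInj_comp` — every copy maps ISOMORPHICALLY onto the quotient: `ι δ ≫ p : S ⟶ Z` is an
  isomorphism (uniqueness of categorical quotients, [MumfordFogartyKirwan1994] Ch. 0 Def. 0.5 / Prop. 0.1, for the two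
  quotients `p` and the fold map of the trivial torsor).  Proof (pure category theory over the cofan API): the fold map `∇ : Y ⟶ S` (`ι δ ≫ ∇ = 𝟙 S`) is invariant,
  so it descends to `∇̄ : Z ⟶ S` with `p ≫ ∇̄ = ∇` (`S` separated); `(ι δ ≫ p) ≫ ∇̄ = ι δ ≫ ∇ = 𝟙 S`; and
  `∇̄ ≫ ι δ ≫ p = 𝟙 Z` by cancelling `p` against the separated target `Z` (`IsSepQuotient.hom_ext`), since
  `p ≫ ∇̄ ≫ ι δ ≫ p = ∇ ≫ ι δ ≫ p = p` — the last equality tested on the copy `δ₁`, which IS the copy `δ` moved by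
  `act (δ₁ δ⁻¹)` (the copies are permuted simply transitively).  No finiteness of `Δ` and no homomorphism property of
  `act` are needed.
* `isIso_cofanInj_comp_of_isSepQuotient` — the same over `k = ℂ` with the binders, in order and kind, of the stub
  `StubTorsorQuotient` of the crux workfile `Cruxes/HypDel/Lines/B1HeckeQuotientDescent.lean` (cell `hodgecm-mathlib`,
  fan B, rung B-I), so that the stub closes by `exact`.

Use: the finite Hecke-quotient step of Deligne's construction of canonical models ([Deligne1971TravauxShimura] Prop. 5.11,
(5.11.1), for a product datum `G × T₀`): the complex fibre of the model is `Δ` copies of `Sh_K(G)(ℂ)` permuted simply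
transitively by the finite group `Δ = T₀(ℚ)\T₀(𝔸_f)/L₀`, and the quotient recovers `Sh_K(G)(ℂ)`.  HC_CM is proved only modulo
the 7 printed citations until rung 0 of the ladder closes; this file is unconditional.

## References
* [MumfordFogartyKirwan1994] D. Mumford, J. Fogarty, F. Kirwan, *Geometric Invariant Theory*, 3rd ed. (1994), Ch. 0 §1
  Def. 0.5 (categorical quotient), §2 Prop. 0.1 («unique up to isomorphism»).
* [SGA1] A. Grothendieck, M. Raynaud, *SGA 1*, Exp. V §1 (quotients by finite groups).
* [MumfordAV1970] D. Mumford, *Abelian Varieties* (1970), §7 Theorem p. 66 and Remark (categorical quotient).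
* [Deligne1971TravauxShimura] P. Deligne, *Travaux de Shimura*, Sém. Bourbaki 389 (1971), Prop. 5.11, (5.11.1).
-/

noncomputable section

open CategoryTheory CategoryTheory.Limits AlgebraicGeometry

namespace Literature.AlgebraicGeometry.Motives

universe u v

section SepQuotientAPI

variable {k : Type u} [Field k] {Δ : Type v} {Y Z : SchemeOver k} {act : Δ → (Y ≅ Y)} {p : Y ⟶ Z}

/-- A separated quotient map is invariant: `act g ≫ p = p`. [cite: MumfordAV1970, §7 Thm. p. 66 (1)] -/
theorem IsSepQuotient.hom_comp (h : IsSepQuotient act p) (g : Δ) : (act g).hom ≫ p = p :=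
  h.1 g

/-- A separated quotient map is invariant under the inverse automorphisms: `(act g)⁻¹ ≫ p = p`.
[cite: MumfordAV1970, §7 Thm. p. 66 (1)] -/
theorem IsSepQuotient.inv_comp (h : IsSepQuotient act p) (g : Δ) : (act g).inv ≫ p = p := by
  rw [Iso.inv_comp_eq, h.hom_comp g]

/-- The universal property: an invariant `k`-morphism to a separated `k`-scheme factors uniquely through `p`.
[cite: MumfordAV1970, §7 Thm. p. 66 (Remark)] -/
theorem IsSepQuotient.existsUnique (h : IsSepQuotient act p) {W : SchemeOver k} (f : Y ⟶ W)
    (hW : IsSeparated W.hom) (hf : ∀ g : Δ, (act g).hom ≫ f = f) : ∃! fbar : Z ⟶ W, p ≫ fbar = f :=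
  h.2 W f hW hf

/-- **Cancellation**: two `k`-morphisms from the quotient to a SEPARATED `k`-scheme that agree after `p` are equal
(`p` is an epimorphism against separated targets: the uniqueness half of the universal property applied to the
invariant morphism `p ≫ b`). [cite: MumfordAV1970, §7 Thm. p. 66 (Remark)] -/
theorem IsSepQuotient.hom_ext (h : IsSepQuotient act p) {W : SchemeOver k} (hW : IsSeparated W.hom) {a b : Z ⟶ W}
    (hab : p ≫ a = p ≫ b) : a = b := by
  have hinv : ∀ g : Δ, (act g).hom ≫ p ≫ b = p ≫ b := fun g => by
    rw [← Category.assoc, h.hom_comp g]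
  exact (h.existsUnique (p ≫ b) hW hinv).unique hab rfl

end SepQuotientAPI

section General

variable {k : Type u} [Field k] {Δ : Type v} [Group Δ] {S Y Z : SchemeOver k}
  {act : Δ → (Y ≅ Y)} {ι : Δ → (S ⟶ Y)}

/-- **Torsor quotient: every summand of `∐_Δ S` maps isomorphically onto the quotient by the translation action.**
If `Y` is the coproduct of copies of `S` indexed by the group `Δ` (colimit cofan `ι`), automorphisms `act g` of `Y`
permute the copies by left translation (`ι δ ≫ act g = ι (g δ)`), and `p : Y ⟶ Z` is a quotient of `Y` by them for
separated test objects, `S` and `Z` being separated over `k`, then `ι δ ≫ p : S ⟶ Z` is an isomorphism for every `δ`.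
This is the uniqueness of categorical quotients up to a unique isomorphism (Mumford–Fogarty–Kirwan, Ch. 0, Def. 0.5
and Prop. 0.1 «hence it is unique up to isomorphism») applied to the two quotients `p` and the fold map
`∇ : ∐_Δ S ⟶ S` of the trivial `Δ`-torsor `∐_Δ S = Δ × S → S`, written out over the cofan API: `∇` (`ι δ ≫ ∇ = 𝟙 S`)
is invariant, so it descends to `∇̄ : Z ⟶ S` with `p ≫ ∇̄ = ∇` (`S` separated); `(ι δ ≫ p) ≫ ∇̄ = ι δ ≫ ∇ = 𝟙`;
and `∇̄ ≫ ι δ ≫ p = 𝟙` by cancelling `p` (`Z` separated) in `p ≫ ∇̄ ≫ ι δ ≫ p = ∇ ≫ ι δ ≫ p = p`, the last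
equality tested on the copy `δ₁ = (δ₁δ⁻¹)·δ`.  No finiteness of `Δ` and no homomorphism property of `act` are
needed. [cite: MumfordFogartyKirwan1994, Ch. 0 §1 Def. 0.5 and §2 Prop. 0.1 (categorical quotients are unique up to isomorphism)] -/
theorem IsSepQuotient.isIso_cofanInj_comp (hc : IsColimit (Cofan.mk Y ι))
    (hact : ∀ g δ : Δ, ι δ ≫ (act g).hom = ι (g * δ)) {p : Y ⟶ Z} (hp : IsSepQuotient act p)
    (hZ : IsSeparated Z.hom) (hS : IsSeparated S.hom) (δ : Δ) : IsIso (ι δ ≫ p) := by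
  -- (1) the fold map `∇ : Y ⟶ S`, a retraction of every copy
  obtain ⟨fold, hfold⟩ : ∃ fold : Y ⟶ S, ∀ δ' : Δ, ι δ' ≫ fold = 𝟙 S :=
    ⟨Cofan.IsColimit.desc hc fun _ : Δ => 𝟙 S, fun δ' => Cofan.IsColimit.fac hc (fun _ : Δ => 𝟙 S) δ'⟩
  -- (2) `∇` is invariant (test on the copy `δ'`: both sides are `𝟙 S`)
  have hinv : ∀ g : Δ, (act g).hom ≫ fold = fold := fun g =>
    Cofan.IsColimit.hom_ext hc _ _ fun δ' => by
      change ι δ' ≫ (act g).hom ≫ fold = ι δ' ≫ fold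
      rw [← Category.assoc, hact g δ', hfold, hfold]
  -- (3) an invariant morphism out of `∐_Δ S` is determined by ONE copy: `∇ ≫ ι δ ≫ p = p`
  --     (test on the copy `δ₁`: `ι δ₁ = ι δ ≫ act (δ₁δ⁻¹)`, and `p` is invariant)
  have hkey : fold ≫ ι δ ≫ p = p :=
    Cofan.IsColimit.hom_ext hc _ _ fun δ₁ => by
      have h₁ : ι δ₁ = ι δ ≫ (act (δ₁ * δ⁻¹)).hom := by rw [hact, inv_mul_cancel_right]
      change ι δ₁ ≫ fold ≫ ι δ ≫ p = ι δ₁ ≫ p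
      rw [← Category.assoc, hfold, Category.id_comp, h₁, Category.assoc, hp.hom_comp]
  -- (4) descend `∇` through the quotient (`∇` invariant, `S` separated)
  obtain ⟨fbar, hfbar⟩ : ∃ fbar : Z ⟶ S, p ≫ fbar = fold := (hp.existsUnique fold hS hinv).exists
  -- (5) `∇̄` is a two-sided inverse of `ι δ ≫ p`; the `Z`-side by cancelling `p` (`Z` separated)
  refine ⟨⟨fbar, ?_, ?_⟩⟩
  · rw [Category.assoc, hfbar, hfold]
  · apply hp.hom_ext hZ
    rw [Category.comp_id, ← Category.assoc, hfbar]
    exact hkey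

end General

/-- **Torsor quotient over `ℂ`, in the binders of the stub `StubTorsorQuotient`** of the crux workfile
`Cruxes/HypDel/Lines/B1HeckeQuotientDescent.lean` (cell `hodgecm-mathlib`, fan B, rung B-I): for a group `Δ`, complex
schemes `S Y Z`, automorphisms `act` of `Y`, a colimit cofan `ι : Δ → (S ⟶ Y)` whose copies `act` permutes by left
translation, and a quotient `p : Y ⟶ Z` for separated test objects with `Z`, `S` separated, every `ι δ ≫ p` is an
isomorphism (`IsSepQuotient.isIso_cofanInj_comp` at `k = ℂ`; the stub closes by `exact` this).  This is the geometric
content of the finite Hecke-quotient step of Deligne's (5.11.1) for a product datum `G × T₀`: the complex fibre of the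
model is `Δ` copies of `Sh_K(G)(ℂ)` permuted simply transitively by `Δ = T₀(ℚ)\T₀(𝔸_f)/L₀`, and the quotient is
`Sh_K(G)(ℂ)`. [cite: MumfordFogartyKirwan1994, Ch. 0 §1 Def. 0.5 and §2 Prop. 0.1 (categorical quotients are unique up to isomorphism)]
[cite: Deligne1971TravauxShimura, Prop. 5.11, (5.11.1) pp. 158–159] -/
theorem isIso_cofanInj_comp_of_isSepQuotient (Δ : Type) [Group Δ] (S Y Z : SchemeOver ℂ) (act : Δ → (Y ≅ Y))
    (ι : Δ → (S ⟶ Y)) (hc : Nonempty (IsColimit (Cofan.mk Y ι)))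
    (hact : ∀ g δ : Δ, ι δ ≫ (act g).hom = ι (g * δ)) (p : Y ⟶ Z) (hZ : IsSeparated Z.hom)
    (hS : IsSeparated S.hom) (hp : IsSepQuotient act p) (δ : Δ) : IsIso (ι δ ≫ p) :=
  hp.isIso_cofanInj_comp hc.some hact hZ hS δ

end Literature.AlgebraicGeometry.Motives

end
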